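import Summits.QuantumFields.YangMills.Theorems.FluctuationComparisonRegPrIntLS2BetaRelativeTowerSupBudgetStart
import Summits.QuantumFields.YangMills.Theorems.FluctuationComparisonRegPrIntLS2BetaRelativeTowerSupBudget128
import Summits.QuantumFields.YangMills.Theorems.FluctuationComparisonRegPrIntLS2BetaChartLetterOfSupProfile
import HarnessLib

/-!
# S2β · the (D♮) REL-TEL road — (L♭) ALONG THE TWO STAGE TOWERS, DISCHARGED MODULO THE DATUM'S SMALL-BOND GAUGE:
# for `γ ≤ γ₁(L, b₀, p₀)` and a datum `V` with bond arcs `≤ M(L)`, the chart conjunct of ✓p822621 `dockRel_inner`'s letter holds for every fibre pair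
# `U, U₀ ∈ fibre(V) ∩ histGood` and every pair of stage towers over the hat lift, with `Σ_j r_j ≤ 2·E(L)` — DEPTH- and VOLUME-FREE

Cell `ym3-torus` (YM ladder rung R3 = continuum `SU(2)` Yang–Mills on the three-torus — a RUNG: NOT d = 4, NOT infinite volume, NOT a mass gap,
NOT Clay).  Width seat «width 12» `ym3-torus-px12` (gen 24), FREE px helper on crux `stmt-QuantumFields-20520`
(`Theses.UnitScaleTilt.FluctuationComparisonRegPrIntL`); `--kind proof --supports stmt-QuantumFields-20520 --as helper`, count-neutral, DEFINITION-FREE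
(0 `def`, 0 `instance`, 0 `notation`, 0 `sorry`, default heartbeats).

WHAT.  ONE composition of this seat's chain: ✓∕⧗`exists_gamma_supBudget_start` (FILE 7: sup profile of ONE stage tower over a datum with arcs `≤ M(L)`,
every level `≤ M ≤ 1∕4`, `Σ s_{t+1}² ≤ 3E(L)`) applied to BOTH towers, then ✓∕⧗`chartLetter_of_two_supProfiles` (FILE 4, over ✓p822698 (L♭) pointwise):
★★★ `exists_gamma_chartLetter (L) (hL) (b₀ p₀)` : `∃ M ∈ (0, 1∕4]`, `∃ E' ≥ 0`, `∃ γ₁ > 0` such that for `F.L = L`, `0 < γ ≤ γ₁`, `J ≤ K`, every datum `V` with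
`arc(V e) ≤ M`, every `U, U₀ ∈ fibre(V) ∩ histGood`, and every pair of gauge families `g, g₀` carrying the stage-tower facts over the geodesic hat lift
((T1) top, (T4) comb axiality, (T5) consistency; hat weights∕lift by px12 g23's formulas), THERE IS `r ≥ 0` with `Σ_{j<K−J} r_j ≤ E'` and
    `‖log U′_{j+1} − log U′₀_{j+1}‖_{ℓ²} ≤ (1 + r_j)·‖dist1(U′_{j+1}·U′₀_{j+1}⁻¹)‖_{ℓ²}`   for every `j < K − J`
(`U′_t := g_t•M^tU`, `U′₀_t := g₀_t•M^tU₀`) — the (L♭) CONJUNCT of ✓p822621's displayed letter, with NO hypothesis left except the datum's small-bond gauge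
(the `G′` guard of ✓p822838 `…S2BetaDatumGaugeWLOG`; its supplier = UV3-NODE §84.3 (S1)∕(S2), un-held).  So, for the record: of (D♮)'s two-tower letter
{(L♭), (H♭)} the chart half is DISCHARGED under `G′`; (H♭) (relative field letter + px10's relative key lemma + corr-rel) is what remains on the distance side.

HONEST SCOPE.  A composition of this seat's landed∕pending helpers with px17's constants; `arc(V e) ≤ M(L)` is a HYPOTHESIS (quantitatively demanding:
`M(5) ≈ 0.0104`); nothing of Bałaban's analysis is asserted ([Balaban1985RegularSpaces] Lemma 1 p.79, (1.29) p.81, (1.65) p.87); (H♭), (D♮), (F♮)∕«CRIT♮»,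
`hIrr`, `hA`, GAP♯∘ (`stub_uniformFibreGapOrbit`), S2β, crux 20520 and `YM3TorusSU2` are NOT proved; no registered stub is closed; rung R3 = SU(2) YM₃ on T³ —
NOT d = 4, NOT infinite volume, NOT a mass gap, NOT Clay; the Yang–Mills mass gap is NOT proved.
-/

set_option autoImplicit false

noncomputable section

namespace Summit.QuantumFields.YangMills.Theorems.FluctuationComparisonRegPrIntLS2BetaChartLetterAlongTowers

open Finset
open scoped Real
open Literature.MathematicalPhysics.QuantumLattice (su2Quat)
open Literature.MathematicalPhysics.QuantumFieldTheory.Balaban1983to89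
open T4Continuum T3ContinuumYM3Torus T3UnitScaleTilt T3TiltDescent T3LevelShift BlockAveraging
open T4CubeChartGnomonic (SU2)
open T4HaarSU2ExpChart (expPoint)
open T4ExpWindowSmallField (logVec)
open T3UnitLawDensityEML (ℰp)
open T3ConstrainedMinimiser (fibre)
open B10Eq27TorusAxialLog (rel axialT)
open Summit.QuantumFields.YangMills.Theorems.FluctuationComparisonRegPrIntLS2BetaRelativeTowerSupBudgetStart (exists_gamma_supBudget_start)
open Summit.QuantumFields.YangMills.Theorems.FluctuationComparisonRegPrIntLS2BetaChartLetterOfSupProfile (chartLetter_of_two_supProfiles)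
open Summit.QuantumFields.YangMills.Theorems.FluctuationComparisonRegPrIntLS2BetaClosePairOfOneStep (iter_eq_of_mem_fibre)

/-- ★★★ **(L♭) ALONG THE TWO STAGE TOWERS, MODULO THE DATUM'S SMALL-BOND GAUGE** — the chart conjunct of ✓p822621 `dockRel_inner`'s letter for EVERY pair
of stage towers over the geodesic hat lift of a fibre pair `U, U₀ ∈ fibre(V) ∩ histGood`, whenever `γ ≤ γ₁(L, b₀, p₀)` and the datum's bonds have arcs
`≤ M(L)`; budget `Σ_{j<K−J} r_j ≤ E'(L)`, depth- and volume-free. [cite: Balaban1985RegularSpaces, Lemma 1 (1.24)-(1.26) p.79, (1.29) p.81, (1.65) p.87; Balaban1987RG1, (0.4) p.253] -/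
theorem exists_gamma_chartLetter (L : ℕ) (hL : 1 < L) (b₀ p₀ : ℝ) (hb : 0 < b₀) (hp : 0 < p₀) :
    ∃ M : ℝ, 0 < M ∧ M ≤ 1 / 4 ∧ ∃ E' : ℝ, 0 ≤ E' ∧ ∃ γ₁ : ℝ, 0 < γ₁ ∧ ∀ (F : T3Family) (γ : ℝ), F.L = L → 0 < γ → γ ≤ γ₁ →
      ∀ (J K : ℕ) (hJK : J ≤ K) (Vd : GaugeField (F.P J) 0 SU2), (∀ e, ‖logVec (su2Quat (Vd e))‖ ≤ M) →
      ∀ (U U₀ : GaugeField (F.P K) 0 SU2), U ∈ fibre F ℰp J K hJK Vd → U ∈ histGood F ℰp (θBal F.L γ b₀ p₀) K J →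
        U₀ ∈ fibre F ℰp J K hJK Vd → U₀ ∈ histGood F ℰp (θBal F.L γ b₀ p₀) K J →
      ∀ (w : (t : ℕ) → PBond (F.P K) t → PBond (F.P K) (t + 1) → ℝ),
        (∀ t, t < K - J → ∀ b e, w t b e = if e.dir = b.dir ∧ (b.src b.dir - emb e.src b.dir).val < (F.P K).L then
          ∏ ν ∈ Finset.univ.erase b.dir, max 0 (1 - ((rel (emb e.src) b.src ν).natAbs : ℝ) / (F.P K).L) else 0) →
      ∀ (g g₀ : (j : ℕ) → Site (F.P K) j → SU2) (V V₀ : (t : ℕ) → GaugeField (F.P K) t SU2),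
        (∀ t, t < K - J → ∀ b, V t b = expPoint (∑ e, w t b e • ((((F.P K).L : ℕ) : ℝ)⁻¹ •
          logVec (su2Quat (GaugeField.gaugeAct (g (t + 1)) (Averaging.iter (fun k => blockAvg (P := F.P K) (j := k) ℰp) (t + 1) U) e))))) →
        (∀ j, K - J ≤ j → ∀ y, g j y = 1) →
        (∀ t, t < K - J → ∀ z : Site (F.P K) t,
          axialT (GaugeField.gaugeAct (g t) (Averaging.iter (fun k => blockAvg (P := F.P K) (j := k) ℰp) t U)) (emb (blockOf z)) z =
            axialT (V t) (emb (blockOf z)) z) →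
        (∀ t, t < K - J → avgFun ℰp (GaugeField.gaugeAct (g t) (Averaging.iter (fun k => blockAvg (P := F.P K) (j := k) ℰp) t U)) =
          GaugeField.gaugeAct (g (t + 1)) (Averaging.iter (fun k => blockAvg (P := F.P K) (j := k) ℰp) (t + 1) U)) →
        (∀ t, t < K - J → ∀ b, V₀ t b = expPoint (∑ e, w t b e • ((((F.P K).L : ℕ) : ℝ)⁻¹ •
          logVec (su2Quat (GaugeField.gaugeAct (g₀ (t + 1)) (Averaging.iter (fun k => blockAvg (P := F.P K) (j := k) ℰp) (t + 1) U₀) e))))) →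
        (∀ j, K - J ≤ j → ∀ y, g₀ j y = 1) →
        (∀ t, t < K - J → ∀ z : Site (F.P K) t,
          axialT (GaugeField.gaugeAct (g₀ t) (Averaging.iter (fun k => blockAvg (P := F.P K) (j := k) ℰp) t U₀)) (emb (blockOf z)) z =
            axialT (V₀ t) (emb (blockOf z)) z) →
        (∀ t, t < K - J → avgFun ℰp (GaugeField.gaugeAct (g₀ t) (Averaging.iter (fun k => blockAvg (P := F.P K) (j := k) ℰp) t U₀)) =
          GaugeField.gaugeAct (g₀ (t + 1)) (Averaging.iter (fun k => blockAvg (P := F.P K) (j := k) ℰp) (t + 1) U₀)) →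
        ∃ r : ℕ → ℝ, (∀ j, 0 ≤ r j) ∧ ∑ j ∈ range (K - J), r j ≤ E' ∧
          ∀ j, j < K - J →
            √(∑ b, ‖logVec (su2Quat (GaugeField.gaugeAct (g (j + 1)) (Averaging.iter (fun k => blockAvg (P := F.P K) (j := k) ℰp) (j + 1) U) b)) -
                  logVec (su2Quat (GaugeField.gaugeAct (g₀ (j + 1)) (Averaging.iter (fun k => blockAvg (P := F.P K) (j := k) ℰp) (j + 1) U₀) b))‖ ^ 2) ≤
              (1 + r j) * √(∑ b, dist1 (GaugeField.gaugeAct (g (j + 1)) (Averaging.iter (fun k => blockAvg (P := F.P K) (j := k) ℰp) (j + 1) U) b *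
                  (GaugeField.gaugeAct (g₀ (j + 1)) (Averaging.iter (fun k => blockAvg (P := F.P K) (j := k) ℰp) (j + 1) U₀) b)⁻¹) ^ 2) := by
  obtain ⟨M, hM0, hM4, E, hE0, γ₁, hγ₁, hsup⟩ := exists_gamma_supBudget_start L hL b₀ p₀ hb hp
  refine ⟨M, hM0, hM4, 2 * E, by positivity, γ₁, hγ₁, ?_⟩
  intro F γ hFL hγ hγ1 J K hJK Vd hVd U U₀ hU hUg hU₀ hU₀g w hw g g₀ V V₀ hV hT1 hax hT5 hV₀ hT1' hax' hT5'
  obtain ⟨s₁, hs₁0, hs₁b, hs₁M, hs₁E⟩ := hsup F γ hFL hγ hγ1 J K hJK Vd hVd U hU hUg g w V hw hV hT1 hax hT5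
  obtain ⟨s₂, hs₂0, hs₂b, hs₂M, hs₂E⟩ := hsup F γ hFL hγ hγ1 J K hJK Vd hVd U₀ hU₀ hU₀g g₀ w V₀ hw hV₀ hT1' hax' hT5'
  have hsq3 : ∀ (x : ℝ), 0 ≤ x → x ≤ M → x ^ 2 ≤ 3 := fun x hx hxM => by nlinarith
  refine chartLetter_of_two_supProfiles (ι := fun t => PBond (F.P K) t) (K - J)
    (fun t => GaugeField.gaugeAct (g t) (Averaging.iter (fun k => blockAvg (P := F.P K) (j := k) ℰp) t U))
    (fun t => GaugeField.gaugeAct (g₀ t) (Averaging.iter (fun k => blockAvg (P := F.P K) (j := k) ℰp) t U₀)) s₁ s₂ (2 * E) (fun b => ?_)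
    (fun t _ ht b => hs₁b t ht.le b) (fun t _ ht b => hs₂b t ht.le b)
    (fun t _ ht => hsq3 _ (hs₁0 t) (hs₁M t ht.le)) (fun t _ ht => hsq3 _ (hs₂0 t) (hs₂M t ht.le)) ?_
  · -- the top: one fibre, trivial top gauges
    have h1 : Averaging.iter (fun k => blockAvg (P := F.P K) (j := k) ℰp) (K - J) U =
        Averaging.iter (fun k => blockAvg (P := F.P K) (j := k) ℰp) (K - J) U₀ := iter_eq_of_mem_fibre F hJK hU hU₀
    have hg : g (K - J) = fun _ => 1 := funext (hT1 (K - J) le_rfl)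
    have hg' : g₀ (K - J) = fun _ => 1 := funext (hT1' (K - J) le_rfl)
    simp only [h1, hg, hg']
  · rw [sum_add_distrib]
    linarith


open Summit.QuantumFields.YangMills.Theorems.FluctuationComparisonRegPrIntLS2BetaRelativeTowerSupBudget128 (exists_gamma_supBudget_128)

/-- ★★★ **(L♭) ALONG THE TWO STAGE TOWERS IN THE EXPLICIT SMALL-BOND GUARD `arc(V e) ≤ 1∕128`** — ✓`exists_gamma_chartLetter` with the datum guard an
EXPLICIT constant (independent of `L, b₀, p₀`), so that a stratum guard `G′ F J V` can carry it; budget `E′ = 2E` of ✓`exists_gamma_supBudget_128`.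
[cite: Balaban1985RegularSpaces, (1.29) p.81, Lemma 1 p.79] -/
theorem exists_gamma_chartLetter_128 (L : ℕ) (hL : 1 < L) (b₀ p₀ : ℝ) (hb : 0 < b₀) (hp : 0 < p₀) :
    ∃ E' : ℝ, 0 ≤ E' ∧ ∃ γ₁ : ℝ, 0 < γ₁ ∧ ∀ (F : T3Family) (γ : ℝ), F.L = L → 0 < γ → γ ≤ γ₁ →
      ∀ (J K : ℕ) (hJK : J ≤ K) (Vd : GaugeField (F.P J) 0 SU2), (∀ e, ‖logVec (su2Quat (Vd e))‖ ≤ 1 / 128) →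
      ∀ (U U₀ : GaugeField (F.P K) 0 SU2), U ∈ fibre F ℰp J K hJK Vd → U ∈ histGood F ℰp (θBal F.L γ b₀ p₀) K J →
        U₀ ∈ fibre F ℰp J K hJK Vd → U₀ ∈ histGood F ℰp (θBal F.L γ b₀ p₀) K J →
      ∀ (w : (t : ℕ) → PBond (F.P K) t → PBond (F.P K) (t + 1) → ℝ),
        (∀ t, t < K - J → ∀ b e, w t b e = if e.dir = b.dir ∧ (b.src b.dir - emb e.src b.dir).val < (F.P K).L then
          ∏ ν ∈ Finset.univ.erase b.dir, max 0 (1 - ((rel (emb e.src) b.src ν).natAbs : ℝ) / (F.P K).L) else 0) →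
      ∀ (g g₀ : (j : ℕ) → Site (F.P K) j → SU2) (V V₀ : (t : ℕ) → GaugeField (F.P K) t SU2),
        (∀ t, t < K - J → ∀ b, V t b = expPoint (∑ e, w t b e • ((((F.P K).L : ℕ) : ℝ)⁻¹ •
          logVec (su2Quat (GaugeField.gaugeAct (g (t + 1)) (Averaging.iter (fun k => blockAvg (P := F.P K) (j := k) ℰp) (t + 1) U) e))))) →
        (∀ j, K - J ≤ j → ∀ y, g j y = 1) →
        (∀ t, t < K - J → ∀ z : Site (F.P K) t,
          axialT (GaugeField.gaugeAct (g t) (Averaging.iter (fun k => blockAvg (P := F.P K) (j := k) ℰp) t U)) (emb (blockOf z)) z =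
            axialT (V t) (emb (blockOf z)) z) →
        (∀ t, t < K - J → avgFun ℰp (GaugeField.gaugeAct (g t) (Averaging.iter (fun k => blockAvg (P := F.P K) (j := k) ℰp) t U)) =
          GaugeField.gaugeAct (g (t + 1)) (Averaging.iter (fun k => blockAvg (P := F.P K) (j := k) ℰp) (t + 1) U)) →
        (∀ t, t < K - J → ∀ b, V₀ t b = expPoint (∑ e, w t b e • ((((F.P K).L : ℕ) : ℝ)⁻¹ •
          logVec (su2Quat (GaugeField.gaugeAct (g₀ (t + 1)) (Averaging.iter (fun k => blockAvg (P := F.P K) (j := k) ℰp) (t + 1) U₀) e))))) →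
        (∀ j, K - J ≤ j → ∀ y, g₀ j y = 1) →
        (∀ t, t < K - J → ∀ z : Site (F.P K) t,
          axialT (GaugeField.gaugeAct (g₀ t) (Averaging.iter (fun k => blockAvg (P := F.P K) (j := k) ℰp) t U₀)) (emb (blockOf z)) z =
            axialT (V₀ t) (emb (blockOf z)) z) →
        (∀ t, t < K - J → avgFun ℰp (GaugeField.gaugeAct (g₀ t) (Averaging.iter (fun k => blockAvg (P := F.P K) (j := k) ℰp) t U₀)) =
          GaugeField.gaugeAct (g₀ (t + 1)) (Averaging.iter (fun k => blockAvg (P := F.P K) (j := k) ℰp) (t + 1) U₀)) →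
        ∃ r : ℕ → ℝ, (∀ j, 0 ≤ r j) ∧ ∑ j ∈ range (K - J), r j ≤ E' ∧
          ∀ j, j < K - J →
            √(∑ b, ‖logVec (su2Quat (GaugeField.gaugeAct (g (j + 1)) (Averaging.iter (fun k => blockAvg (P := F.P K) (j := k) ℰp) (j + 1) U) b)) -
                  logVec (su2Quat (GaugeField.gaugeAct (g₀ (j + 1)) (Averaging.iter (fun k => blockAvg (P := F.P K) (j := k) ℰp) (j + 1) U₀) b))‖ ^ 2) ≤
              (1 + r j) * √(∑ b, dist1 (GaugeField.gaugeAct (g (j + 1)) (Averaging.iter (fun k => blockAvg (P := F.P K) (j := k) ℰp) (j + 1) U) b *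
                  (GaugeField.gaugeAct (g₀ (j + 1)) (Averaging.iter (fun k => blockAvg (P := F.P K) (j := k) ℰp) (j + 1) U₀) b)⁻¹) ^ 2) := by
  obtain ⟨E, hE0, γ₁, hγ₁, hsup⟩ := exists_gamma_supBudget_128 L hL b₀ p₀ hb hp
  refine ⟨2 * E, by positivity, γ₁, hγ₁, ?_⟩
  intro F γ hFL hγ hγ1 J K hJK Vd hVd U U₀ hU hUg hU₀ hU₀g w hw g g₀ V V₀ hV hT1 hax hT5 hV₀ hT1' hax' hT5'
  obtain ⟨s₁, hs₁0, hs₁b, hs₁M, -, hs₁E⟩ := hsup F γ hFL hγ hγ1 J K hJK Vd hVd U hU hUg g w V hw hV hT1 hax hT5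
  obtain ⟨s₂, hs₂0, hs₂b, hs₂M, -, hs₂E⟩ := hsup F γ hFL hγ hγ1 J K hJK Vd hVd U₀ hU₀ hU₀g g₀ w V₀ hw hV₀ hT1' hax' hT5'
  have hsq3 : ∀ (x : ℝ), 0 ≤ x → x ≤ 1 / 4 → x ^ 2 ≤ 3 := fun x hx hxM => by nlinarith
  refine chartLetter_of_two_supProfiles (ι := fun t => PBond (F.P K) t) (K - J)
    (fun t => GaugeField.gaugeAct (g t) (Averaging.iter (fun k => blockAvg (P := F.P K) (j := k) ℰp) t U))
    (fun t => GaugeField.gaugeAct (g₀ t) (Averaging.iter (fun k => blockAvg (P := F.P K) (j := k) ℰp) t U₀)) s₁ s₂ (2 * E) (fun b => ?_)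
    (fun t _ ht b => hs₁b t ht.le b) (fun t _ ht b => hs₂b t ht.le b)
    (fun t _ ht => hsq3 _ (hs₁0 t) (hs₁M t ht.le)) (fun t _ ht => hsq3 _ (hs₂0 t) (hs₂M t ht.le)) ?_
  · -- the top: one fibre, trivial top gauges
    have h1 : Averaging.iter (fun k => blockAvg (P := F.P K) (j := k) ℰp) (K - J) U =
        Averaging.iter (fun k => blockAvg (P := F.P K) (j := k) ℰp) (K - J) U₀ := iter_eq_of_mem_fibre F hJK hU hU₀
    have hg : g (K - J) = fun _ => 1 := funext (hT1 (K - J) le_rfl)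
    have hg' : g₀ (K - J) = fun _ => 1 := funext (hT1' (K - J) le_rfl)
    simp only [h1, hg, hg']
  · rw [sum_add_distrib]
    linarith

end Summit.QuantumFields.YangMills.Theorems.FluctuationComparisonRegPrIntLS2BetaChartLetterAlongTowers

end
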